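import Mathlib.Analysis.Calculus.IteratedDeriv.Lemmas
import Mathlib.Analysis.SpecialFunctions.Complex.Circle
import Mathlib.Analysis.SpecialFunctions.ExpDeriv
import Literature.NumberTheory.Rogawski1990.ArchCentralLimitFunctionalSymmetry
import Literature.NumberTheory.Rogawski1990.ArchCentralLimitFunctionalOrbitalRays
import HarnessLib

/-!
# Compact-wall normal-line Leibniz readings for the archimedean central-limit functional

Rogawski, *Automorphic representations of unitary groups in three variables* (1990), §8.4 pp. 126–127
(Harish-Chandra's limit formula at the centre of `U(2,1)`, `∂(ϖ)[′Δ·Φ_f] → c·f(γ₀)`), read through the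
*compact wall* `{z₀ = z₁}` of the diagonal torus `U(1)³` (the singular set of the compact root `e₀ − e₁`;
centraliser `U(2) × U(1)`).  By ★ `lambda8_eq_quarter_wall_jets` the letter's 8-ray functional is
`Λ₈[G](z) = ¼·(A²N − N³)G` with `N⃗ = (1,−1,0)` normal and `A⃗ = (1,1,−2)` tangent to the wall, so at a
wall point `k` (`k₀ = k₁`) everything is governed by the jets of `G = ρ′Δ·Φ` along the NORMAL RAY
`s ↦ k·e^{isN⃗} = (k₀e^{is}, k₀e^{−is}, k₂)`.  This file supplies those jets:

* §1 parity calculus on `ℝ → ℂ`: odd derivatives of an even germ and even derivatives of an odd germ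
  vanish at `0`; the Leibniz readings `(DP)′(0) = D′(0)P(0)`, `(DP)″(0) = 0`,
  `(DP)‴(0) = D‴(0)P(0) + 3D′(0)P″(0)` for `D` odd and `P` even (Mathlib `iteratedDeriv_mul`);
* §2 the normal ray through a compact-wall point: the Weyl reflection `(0 1)` reverses it
  (`ray(s) ∘ (0 1) = ray(−s)`), hence `P(s) = Φ(ray s)` is EVEN for every `Φ` invariant under the compact
  Weyl reflection (`Φ(z ∘ (0 1)) = Φ z` — true for stable orbital integrals, the reflection being realised in
  `U(2) × U(1)`), and `D(s) = ρ′Δ(ray s)` is ODD (★ `rhoWeylDelta_comp_perm`: `ρ′Δ` is alternating);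
* §3 the closed form `D(s) = (k₀/k₂)·((1 + w²)(e^{is} − e^{−is}) − w(e^{2is} − e^{−2is}))`, `w = k₂/k₀`, and
  its jets `D⁽ⁿ⁾(0) = (k₀/k₂)·((1 + w²)(iⁿ − (−i)ⁿ) − w((2i)ⁿ − (−2i)ⁿ))`; in particular
  `D′(0) = 2i·w̄·(1 − w)²` (at `w = e^{iε}`: `−8i·sin²(ε/2)`, the `ε²` that tames `Φ_{O_v} ~ ε⁻²`) and
  `D‴(0) = 2i·w̄·(8w − 1 − w²)`;
* §4 the wall readings of `NF`, `N²F`, `N³F` for `F = ρ′Δ·Φ` in the letter's verbatim token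
  (`(fun z′ ↦ ρ′Δ(z′)·Φ(z′)) (k·e^{isN⃗})`, the shape produced by ★ `lambda8_eq_quarter_wall_jets`):
  `NF(k) = D′(0)·Φ(k)`, `N²F(k) = 0`, `N³F(k) = D‴(0)·Φ(k) + 3·D′(0)·N²Φ(k)`.
-/

namespace Literature.NumberTheory.Rogawski1990

open scoped BigOperators ContDiff Topology
open Complex

/-! ## §1 Parity calculus and the Leibniz readings on `ℝ → ℂ` -/

section Parity

/-- Odd-order derivatives of an even germ vanish at `0`. [cite: Rogawski1990, §8.4 p. 126] -/
theorem iteratedDeriv_eq_zero_of_even_fun {g : ℝ → ℂ} (hg : ∀ s, g (-s) = g s) {n : ℕ} (hn : Odd n) :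
    iteratedDeriv n g 0 = 0 := by
  have h := iteratedDeriv_comp_neg n g 0
  have hfun : (fun x => g (-x)) = g := funext hg
  rw [hfun, neg_zero, hn.neg_one_pow, neg_one_smul] at h
  have h2 : (2 : ℂ) * iteratedDeriv n g 0 = 0 := by linear_combination h
  simpa using h2

/-- Even-order derivatives of an odd germ vanish at `0`. [cite: Rogawski1990, §8.4 p. 126] -/
theorem iteratedDeriv_eq_zero_of_odd_fun {f : ℝ → ℂ} (hf : ∀ s, f (-s) = -f s) {n : ℕ} (hn : Even n) :
    iteratedDeriv n f 0 = 0 := by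
  have h := iteratedDeriv_comp_neg n f 0
  have hfun : (fun x => f (-x)) = fun x => -f x := funext hf
  rw [hfun, iteratedDeriv_fun_neg, neg_zero, hn.neg_one_pow, one_smul] at h
  have h2 : (2 : ℂ) * iteratedDeriv n f 0 = 0 := by linear_combination -h
  simpa using h2

/-- An odd germ vanishes at `0`. [cite: Rogawski1990, §8.4 p. 126] -/
theorem apply_zero_eq_zero_of_odd_fun {f : ℝ → ℂ} (hf : ∀ s, f (-s) = -f s) : f 0 = 0 := by
  have h := hf 0
  rw [neg_zero] at h
  have h2 : (2 : ℂ) * f 0 = 0 := by linear_combination h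
  simpa using h2

/-- **Leibniz, first order**: `(D·P)′(0) = D′(0)·P(0)` for `D` odd (so `D(0) = 0`).
[cite: Rogawski1990, §8.4 p. 126] -/
theorem deriv_mul_eq_of_odd {D P : ℝ → ℂ} (hD : ContDiffAt ℝ 1 D 0) (hP : ContDiffAt ℝ 1 P 0)
    (hDodd : ∀ s, D (-s) = -D s) :
    deriv (fun s => D s * P s) 0 = deriv D 0 * P 0 := by
  have h := iteratedDeriv_fun_mul (n := 1) (x := (0 : ℝ)) hD hP
  rw [iteratedDeriv_one] at h
  rw [h, Finset.sum_range_succ, Finset.sum_range_succ, Finset.sum_range_zero]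
  simp only [iteratedDeriv_zero, iteratedDeriv_one, apply_zero_eq_zero_of_odd_fun hDodd]
  norm_num

/-- **Leibniz, second order**: `(D·P)″(0) = 0` for `D` odd and `P` even. [cite: Rogawski1990, §8.4 p. 126] -/
theorem iteratedDeriv_two_mul_eq_zero_of_odd_even {D P : ℝ → ℂ} (hD : ContDiffAt ℝ 2 D 0) (hP : ContDiffAt ℝ 2 P 0)
    (hDodd : ∀ s, D (-s) = -D s) (hPeven : ∀ s, P (-s) = P s) :
    iteratedDeriv 2 (fun s => D s * P s) 0 = 0 := by
  have h := iteratedDeriv_fun_mul (n := 2) (x := (0 : ℝ)) hD hP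
  rw [h, Finset.sum_range_succ, Finset.sum_range_succ, Finset.sum_range_succ, Finset.sum_range_zero]
  simp only [iteratedDeriv_zero, apply_zero_eq_zero_of_odd_fun hDodd,
    iteratedDeriv_eq_zero_of_even_fun hPeven (n := 1) odd_one,
    iteratedDeriv_eq_zero_of_odd_fun hDodd (n := 2) even_two]
  norm_num

/-- **Leibniz, third order**: `(D·P)‴(0) = D‴(0)·P(0) + 3·D′(0)·P″(0)` for `D` odd and `P` even.
[cite: Rogawski1990, §8.4 p. 126] -/
theorem iteratedDeriv_three_mul_eq_of_odd_even {D P : ℝ → ℂ} (hD : ContDiffAt ℝ 3 D 0) (hP : ContDiffAt ℝ 3 P 0)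
    (hDodd : ∀ s, D (-s) = -D s) (hPeven : ∀ s, P (-s) = P s) :
    iteratedDeriv 3 (fun s => D s * P s) 0 = iteratedDeriv 3 D 0 * P 0 + 3 * deriv D 0 * iteratedDeriv 2 P 0 := by
  have h := iteratedDeriv_fun_mul (n := 3) (x := (0 : ℝ)) hD hP
  rw [h, Finset.sum_range_succ, Finset.sum_range_succ, Finset.sum_range_succ, Finset.sum_range_succ, Finset.sum_range_zero]
  simp only [iteratedDeriv_zero, iteratedDeriv_one, apply_zero_eq_zero_of_odd_fun hDodd,
    iteratedDeriv_eq_zero_of_even_fun hPeven (n := 1) odd_one,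
    iteratedDeriv_eq_zero_of_odd_fun hDodd (n := 2) even_two]
  norm_num [Nat.choose]
  ring

end Parity

/-! ## §2 The normal ray through a compact-wall point -/

section NormalRay

/-- The compact Weyl reflection `(0 1)` REVERSES the normal ray through a wall point `k` (`k₀ = k₁`):
`(k·e^{isN⃗}) ∘ (0 1) = k·e^{−isN⃗}`, `N⃗ = (1,−1,0)`. [cite: Rogawski1990, §8.4 p. 126] -/
theorem normalRay_comp_swap (k : Fin 3 → Circle) (hk : k 0 = k 1) (s : ℝ) :
    ((fun j => k j * Circle.exp (s * (![1, -1, 0] : Fin 3 → ℝ) j)) ∘ (Equiv.swap (0 : Fin 3) 1)) =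
      fun j => k j * Circle.exp ((-s) * (![1, -1, 0] : Fin 3 → ℝ) j) := by
  funext j
  fin_cases j <;> simp [Equiv.swap_apply_of_ne_of_ne, hk]

/-- The normal ray passes through `k` at `s = 0`. [cite: Rogawski1990, §8.4 p. 126] -/
theorem normalRay_zero (k : Fin 3 → Circle) :
    (fun j => k j * Circle.exp ((0 : ℝ) * (![1, -1, 0] : Fin 3 → ℝ) j)) = k := by
  funext j
  simp

/-- **`P(s) = Φ(k·e^{isN⃗})` is EVEN** for `Φ` invariant under the compact Weyl reflection.
[cite: Rogawski1990, §8.4 p. 126] -/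
theorem comp_normalRay_even (Φ : (Fin 3 → Circle) → ℂ) (hΦ : ∀ z : Fin 3 → Circle, Φ (z ∘ (Equiv.swap (0 : Fin 3) 1)) = Φ z)
    (k : Fin 3 → Circle) (hk : k 0 = k 1) (s : ℝ) :
    Φ (fun j => k j * Circle.exp ((-s) * (![1, -1, 0] : Fin 3 → ℝ) j)) = Φ (fun j => k j * Circle.exp (s * (![1, -1, 0] : Fin 3 → ℝ) j)) := by
  rw [← normalRay_comp_swap k hk s, hΦ]

/-- **`D(s) = ρ′Δ(k·e^{isN⃗})` is ODD** (`ρ′Δ` alternating, ★ `rhoWeylDelta_comp_perm`). [cite: Rogawski1990, §8.4 p. 126] -/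
theorem rhoWeylDelta_normalRay_odd (k : Fin 3 → Circle) (hk : k 0 = k 1) (s : ℝ) :
    ((k 0 * Circle.exp ((-s) * (![1, -1, 0] : Fin 3 → ℝ) 0) : Circle) : ℂ) * (((k 2 * Circle.exp ((-s) * (![1, -1, 0] : Fin 3 → ℝ) 2) : Circle) : ℂ))⁻¹ *
        ((1 - ((k 1 * Circle.exp ((-s) * (![1, -1, 0] : Fin 3 → ℝ) 1) : Circle) : ℂ) * (((k 0 * Circle.exp ((-s) * (![1, -1, 0] : Fin 3 → ℝ) 0) : Circle) : ℂ))⁻¹) *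
          (1 - ((k 2 * Circle.exp ((-s) * (![1, -1, 0] : Fin 3 → ℝ) 2) : Circle) : ℂ) * (((k 1 * Circle.exp ((-s) * (![1, -1, 0] : Fin 3 → ℝ) 1) : Circle) : ℂ))⁻¹) *
          (1 - ((k 2 * Circle.exp ((-s) * (![1, -1, 0] : Fin 3 → ℝ) 2) : Circle) : ℂ) * (((k 0 * Circle.exp ((-s) * (![1, -1, 0] : Fin 3 → ℝ) 0) : Circle) : ℂ))⁻¹)) =
      -(((k 0 * Circle.exp (s * (![1, -1, 0] : Fin 3 → ℝ) 0) : Circle) : ℂ) * (((k 2 * Circle.exp (s * (![1, -1, 0] : Fin 3 → ℝ) 2) : Circle) : ℂ))⁻¹ *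
        ((1 - ((k 1 * Circle.exp (s * (![1, -1, 0] : Fin 3 → ℝ) 1) : Circle) : ℂ) * (((k 0 * Circle.exp (s * (![1, -1, 0] : Fin 3 → ℝ) 0) : Circle) : ℂ))⁻¹) *
          (1 - ((k 2 * Circle.exp (s * (![1, -1, 0] : Fin 3 → ℝ) 2) : Circle) : ℂ) * (((k 1 * Circle.exp (s * (![1, -1, 0] : Fin 3 → ℝ) 1) : Circle) : ℂ))⁻¹) *
          (1 - ((k 2 * Circle.exp (s * (![1, -1, 0] : Fin 3 → ℝ) 2) : Circle) : ℂ) * (((k 0 * Circle.exp (s * (![1, -1, 0] : Fin 3 → ℝ) 0) : Circle) : ℂ))⁻¹))) := by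
  -- the ray as a `ℂ`-valued triple, and its reversal as the `(0 1)`-relabelling
  set r : Fin 3 → ℂ := fun j => ((k j * Circle.exp (s * (![1, -1, 0] : Fin 3 → ℝ) j) : Circle) : ℂ) with hr
  have hrne : ∀ j, r j ≠ 0 := fun j => Circle.coe_ne_zero _
  have hrev : ∀ j, ((k j * Circle.exp ((-s) * (![1, -1, 0] : Fin 3 → ℝ) j) : Circle) : ℂ) = (r ∘ (Equiv.swap (0 : Fin 3) 1)) j := by
    intro j
    have h := congrFun (normalRay_comp_swap k hk s) j
    simp only [hr, Function.comp_apply] at h ⊢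
    rw [h]
  have h := rhoWeylDelta_comp_perm (Equiv.swap (0 : Fin 3) 1) r hrne
  rw [Equiv.Perm.sign_swap (by decide)] at h
  simp only [hrev]
  rw [h]
  simp only [hr]
  push_cast
  ring

end NormalRay

/-! ## §3 The closed form of `D(s) = ρ′Δ(k·e^{isN⃗})` and its jets -/

section ClosedForm

/-- `(d/ds)ⁿ e^{cs} = cⁿ e^{cs}` for `s` real, `c` complex. [cite: Rogawski1990, §8.4 p. 126] -/
theorem iteratedDeriv_cexp_mul_ofReal (c : ℂ) (n : ℕ) :
    iteratedDeriv n (fun s : ℝ => Complex.exp (c * s)) = fun s : ℝ => c ^ n * Complex.exp (c * s) := by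
  induction n with
  | zero => funext s; simp
  | succ n ih =>
    rw [iteratedDeriv_succ, ih]
    funext s
    have h1 : HasDerivAt (fun s : ℝ => c * (s : ℂ)) (c * 1) s := by
      simpa using ((hasDerivAt_id s).ofReal_comp).const_mul c
    have h2 : HasDerivAt (fun s : ℝ => c ^ n * Complex.exp (c * s)) (c ^ n * (Complex.exp (c * s) * (c * 1))) s :=
      (h1.cexp).const_mul _
    rw [h2.deriv]
    ring

/-- `s ↦ e^{cs}` is smooth on `ℝ`. [cite: Rogawski1990, §8.4 p. 126] -/
theorem contDiff_cexp_mul_ofReal (c : ℂ) : ContDiff ℝ ∞ fun s : ℝ => Complex.exp (c * s) :=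
  (Complex.contDiff_exp (𝕜 := ℝ)).comp (contDiff_const.mul Complex.ofRealCLM.contDiff)

/-- **Closed form of `ρ′Δ` along the normal ray** through a compact-wall point `k` (`k₀ = k₁`, `w = k₂/k₀`):
`ρ′Δ(k·e^{isN⃗}) = (k₀/k₂)·((1 + w²)(e^{is} − e^{−is}) − w(e^{2is} − e^{−2is}))` (`= 2i·w̄·sin s·(1 − 2w cos s + w²)`).
[cite: Rogawski1990, §8.4 p. 126] -/
theorem rhoWeylDelta_normalRay_eq (k : Fin 3 → Circle) (hk : k 0 = k 1) (s : ℝ) :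
    ((k 0 * Circle.exp (s * (![1, -1, 0] : Fin 3 → ℝ) 0) : Circle) : ℂ) * (((k 2 * Circle.exp (s * (![1, -1, 0] : Fin 3 → ℝ) 2) : Circle) : ℂ))⁻¹ *
        ((1 - ((k 1 * Circle.exp (s * (![1, -1, 0] : Fin 3 → ℝ) 1) : Circle) : ℂ) * (((k 0 * Circle.exp (s * (![1, -1, 0] : Fin 3 → ℝ) 0) : Circle) : ℂ))⁻¹) *
          (1 - ((k 2 * Circle.exp (s * (![1, -1, 0] : Fin 3 → ℝ) 2) : Circle) : ℂ) * (((k 1 * Circle.exp (s * (![1, -1, 0] : Fin 3 → ℝ) 1) : Circle) : ℂ))⁻¹) *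
          (1 - ((k 2 * Circle.exp (s * (![1, -1, 0] : Fin 3 → ℝ) 2) : Circle) : ℂ) * (((k 0 * Circle.exp (s * (![1, -1, 0] : Fin 3 → ℝ) 0) : Circle) : ℂ))⁻¹)) =
      (k 0 : ℂ) * ((k 2 : ℂ))⁻¹ *
        ((1 + ((k 2 : ℂ) * ((k 0 : ℂ))⁻¹) ^ 2) * (Complex.exp (I * s) - Complex.exp (-I * s))
          - ((k 2 : ℂ) * ((k 0 : ℂ))⁻¹) * (Complex.exp (2 * I * s) - Complex.exp (-(2 * I) * s))) := by
  have h0 : (k 0 : ℂ) ≠ 0 := Circle.coe_ne_zero _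
  have h2 : (k 2 : ℂ) ≠ 0 := Circle.coe_ne_zero _
  have hE : Complex.exp (I * s) ≠ 0 := Complex.exp_ne_zero _
  have hneg : Complex.exp (-I * s) = (Complex.exp (I * s))⁻¹ := by
    rw [← Complex.exp_neg]; ring_nf
  have htwo : Complex.exp (2 * I * s) = Complex.exp (I * s) ^ 2 := by
    rw [sq, ← Complex.exp_add]; ring_nf
  have hnegtwo : Complex.exp (-(2 * I) * s) = (Complex.exp (I * s) ^ 2)⁻¹ := by
    rw [← htwo, ← Complex.exp_neg]; ring_nf
  have c0 : ((k 0 * Circle.exp (s * (![1, -1, 0] : Fin 3 → ℝ) 0) : Circle) : ℂ) = (k 0 : ℂ) * Complex.exp (I * s) := by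
    rw [Circle.coe_mul, Circle.coe_exp]; simp [mul_comm]
  have c1 : ((k 1 * Circle.exp (s * (![1, -1, 0] : Fin 3 → ℝ) 1) : Circle) : ℂ) = (k 0 : ℂ) * (Complex.exp (I * s))⁻¹ := by
    rw [Circle.coe_mul, Circle.coe_exp, ← hk, ← Complex.exp_neg]; simp [mul_comm]
  have c2 : ((k 2 * Circle.exp (s * (![1, -1, 0] : Fin 3 → ℝ) 2) : Circle) : ℂ) = (k 2 : ℂ) := by
    rw [Circle.coe_mul, Circle.coe_exp]; simp
  rw [c0, c1, c2, hneg, htwo, hnegtwo]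
  field_simp
  ring

/-- **Jets of `D(s) = ρ′Δ(k·e^{isN⃗})` at the wall**: `D⁽ⁿ⁾(0) = (k₀/k₂)·((1 + w²)(iⁿ − (−i)ⁿ) − w((2i)ⁿ − (−2i)ⁿ))`.
[cite: Rogawski1990, §8.4 p. 126] -/
theorem iteratedDeriv_rhoWeylDelta_normalRay_zero (k : Fin 3 → Circle) (hk : k 0 = k 1) (n : ℕ) :
    iteratedDeriv n (fun s : ℝ =>
      ((k 0 * Circle.exp (s * (![1, -1, 0] : Fin 3 → ℝ) 0) : Circle) : ℂ) * (((k 2 * Circle.exp (s * (![1, -1, 0] : Fin 3 → ℝ) 2) : Circle) : ℂ))⁻¹ *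
        ((1 - ((k 1 * Circle.exp (s * (![1, -1, 0] : Fin 3 → ℝ) 1) : Circle) : ℂ) * (((k 0 * Circle.exp (s * (![1, -1, 0] : Fin 3 → ℝ) 0) : Circle) : ℂ))⁻¹) *
          (1 - ((k 2 * Circle.exp (s * (![1, -1, 0] : Fin 3 → ℝ) 2) : Circle) : ℂ) * (((k 1 * Circle.exp (s * (![1, -1, 0] : Fin 3 → ℝ) 1) : Circle) : ℂ))⁻¹) *
          (1 - ((k 2 * Circle.exp (s * (![1, -1, 0] : Fin 3 → ℝ) 2) : Circle) : ℂ) * (((k 0 * Circle.exp (s * (![1, -1, 0] : Fin 3 → ℝ) 0) : Circle) : ℂ))⁻¹))) 0 =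
      (k 0 : ℂ) * ((k 2 : ℂ))⁻¹ *
        ((1 + ((k 2 : ℂ) * ((k 0 : ℂ))⁻¹) ^ 2) * (I ^ n - (-I) ^ n)
          - ((k 2 : ℂ) * ((k 0 : ℂ))⁻¹) * ((2 * I) ^ n - (-(2 * I)) ^ n)) := by
  have hfun : (fun s : ℝ =>
      ((k 0 * Circle.exp (s * (![1, -1, 0] : Fin 3 → ℝ) 0) : Circle) : ℂ) * (((k 2 * Circle.exp (s * (![1, -1, 0] : Fin 3 → ℝ) 2) : Circle) : ℂ))⁻¹ *
        ((1 - ((k 1 * Circle.exp (s * (![1, -1, 0] : Fin 3 → ℝ) 1) : Circle) : ℂ) * (((k 0 * Circle.exp (s * (![1, -1, 0] : Fin 3 → ℝ) 0) : Circle) : ℂ))⁻¹) *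
          (1 - ((k 2 * Circle.exp (s * (![1, -1, 0] : Fin 3 → ℝ) 2) : Circle) : ℂ) * (((k 1 * Circle.exp (s * (![1, -1, 0] : Fin 3 → ℝ) 1) : Circle) : ℂ))⁻¹) *
          (1 - ((k 2 * Circle.exp (s * (![1, -1, 0] : Fin 3 → ℝ) 2) : Circle) : ℂ) * (((k 0 * Circle.exp (s * (![1, -1, 0] : Fin 3 → ℝ) 0) : Circle) : ℂ))⁻¹))) =
      fun s : ℝ => (k 0 : ℂ) * ((k 2 : ℂ))⁻¹ * (1 + ((k 2 : ℂ) * ((k 0 : ℂ))⁻¹) ^ 2) * Complex.exp (I * s)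
        + (-((k 0 : ℂ) * ((k 2 : ℂ))⁻¹ * (1 + ((k 2 : ℂ) * ((k 0 : ℂ))⁻¹) ^ 2))) * Complex.exp (-I * s)
        + (-((k 0 : ℂ) * ((k 2 : ℂ))⁻¹ * ((k 2 : ℂ) * ((k 0 : ℂ))⁻¹))) * Complex.exp (2 * I * s)
        + ((k 0 : ℂ) * ((k 2 : ℂ))⁻¹ * ((k 2 : ℂ) * ((k 0 : ℂ))⁻¹)) * Complex.exp (-(2 * I) * s) := by
    funext s
    rw [rhoWeylDelta_normalRay_eq k hk s]
    ring
  rw [hfun]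
  have hcd : ∀ a c : ℂ, ContDiffAt ℝ (n : WithTop ℕ∞) (fun s : ℝ => a * Complex.exp (c * s)) 0 := fun a c =>
    (contDiffAt_const.mul (contDiff_cexp_mul_ofReal c).contDiffAt).of_le
      (by exact_mod_cast ENat.natCast_le_of_coe_top_le_withTop le_rfl n)
  rw [iteratedDeriv_fun_add (((hcd _ _).add (hcd _ _)).add (hcd _ _)) (hcd _ _),
    iteratedDeriv_fun_add ((hcd _ _).add (hcd _ _)) (hcd _ _), iteratedDeriv_fun_add (hcd _ _) (hcd _ _)]
  simp only [iteratedDeriv_const_mul_field, iteratedDeriv_cexp_mul_ofReal]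
  simp only [Complex.ofReal_zero, mul_zero, Complex.exp_zero, mul_one]
  ring

/-- **`D′(0) = 2i·w̄·(1 − w)²`**, `w = k₂/k₀` (`= −8i·sin²(ε/2)` at `w = e^{iε}`). [cite: Rogawski1990, §8.4 p. 126] -/
theorem deriv_rhoWeylDelta_normalRay_zero (k : Fin 3 → Circle) (hk : k 0 = k 1) :
    deriv (fun s : ℝ =>
      ((k 0 * Circle.exp (s * (![1, -1, 0] : Fin 3 → ℝ) 0) : Circle) : ℂ) * (((k 2 * Circle.exp (s * (![1, -1, 0] : Fin 3 → ℝ) 2) : Circle) : ℂ))⁻¹ *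
        ((1 - ((k 1 * Circle.exp (s * (![1, -1, 0] : Fin 3 → ℝ) 1) : Circle) : ℂ) * (((k 0 * Circle.exp (s * (![1, -1, 0] : Fin 3 → ℝ) 0) : Circle) : ℂ))⁻¹) *
          (1 - ((k 2 * Circle.exp (s * (![1, -1, 0] : Fin 3 → ℝ) 2) : Circle) : ℂ) * (((k 1 * Circle.exp (s * (![1, -1, 0] : Fin 3 → ℝ) 1) : Circle) : ℂ))⁻¹) *
          (1 - ((k 2 * Circle.exp (s * (![1, -1, 0] : Fin 3 → ℝ) 2) : Circle) : ℂ) * (((k 0 * Circle.exp (s * (![1, -1, 0] : Fin 3 → ℝ) 0) : Circle) : ℂ))⁻¹))) 0 =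
      2 * I * ((k 0 : ℂ) * ((k 2 : ℂ))⁻¹) * (1 - (k 2 : ℂ) * ((k 0 : ℂ))⁻¹) ^ 2 := by
  rw [← iteratedDeriv_one, iteratedDeriv_rhoWeylDelta_normalRay_zero k hk 1]
  ring

/-- **`D‴(0) = 2i·w̄·(8w − 1 − w²)`**, `w = k₂/k₀`. [cite: Rogawski1990, §8.4 p. 126] -/
theorem iteratedDeriv_three_rhoWeylDelta_normalRay_zero (k : Fin 3 → Circle) (hk : k 0 = k 1) :
    iteratedDeriv 3 (fun s : ℝ =>
      ((k 0 * Circle.exp (s * (![1, -1, 0] : Fin 3 → ℝ) 0) : Circle) : ℂ) * (((k 2 * Circle.exp (s * (![1, -1, 0] : Fin 3 → ℝ) 2) : Circle) : ℂ))⁻¹ *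
        ((1 - ((k 1 * Circle.exp (s * (![1, -1, 0] : Fin 3 → ℝ) 1) : Circle) : ℂ) * (((k 0 * Circle.exp (s * (![1, -1, 0] : Fin 3 → ℝ) 0) : Circle) : ℂ))⁻¹) *
          (1 - ((k 2 * Circle.exp (s * (![1, -1, 0] : Fin 3 → ℝ) 2) : Circle) : ℂ) * (((k 1 * Circle.exp (s * (![1, -1, 0] : Fin 3 → ℝ) 1) : Circle) : ℂ))⁻¹) *
          (1 - ((k 2 * Circle.exp (s * (![1, -1, 0] : Fin 3 → ℝ) 2) : Circle) : ℂ) * (((k 0 * Circle.exp (s * (![1, -1, 0] : Fin 3 → ℝ) 0) : Circle) : ℂ))⁻¹))) 0 =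
      2 * I * ((k 0 : ℂ) * ((k 2 : ℂ))⁻¹) * (8 * ((k 2 : ℂ) * ((k 0 : ℂ))⁻¹) - 1 - ((k 2 : ℂ) * ((k 0 : ℂ))⁻¹) ^ 2) := by
  rw [iteratedDeriv_rhoWeylDelta_normalRay_zero k hk 3]
  linear_combination (2 * ((k 0 : ℂ) * ((k 2 : ℂ))⁻¹) * ((1 + ((k 2 : ℂ) * ((k 0 : ℂ))⁻¹) ^ 2) - 8 * ((k 2 : ℂ) * ((k 0 : ℂ))⁻¹)) * I)
    * Complex.I_sq

end ClosedForm

/-! ## §4 The wall readings of `NF`, `N²F`, `N³F` for `F = ρ′Δ·Φ` -/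

section WallReadings

/-- **`NF(k) = D′(0)·Φ(k)`** at a compact-wall point, in the letter's token: for `Φ` of class `C¹` along the
normal ray (no parity needed at first order since `ρ′Δ(k) = 0`),
`(d/ds)|₀ (ρ′Δ·Φ)(k·e^{isN⃗}) = 2i·(k₀/k₂)·(1 − k₂/k₀)²·Φ(k)`. [cite: Rogawski1990, §8.4 pp. 126–127] -/
theorem deriv_rhoWeylDelta_mul_normalRay_zero (Φ : (Fin 3 → Circle) → ℂ) (k : Fin 3 → Circle) (hk : k 0 = k 1)
    (hP : ContDiffAt ℝ 1 (fun s : ℝ => Φ (fun j => k j * Circle.exp (s * (![1, -1, 0] : Fin 3 → ℝ) j))) 0) :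
    deriv (fun s : ℝ => (fun z' : Fin 3 → Circle =>
        ((z' 0 : ℂ) * ((z' 2 : ℂ))⁻¹ * ((1 - (z' 1 : ℂ) * ((z' 0 : ℂ))⁻¹) * (1 - (z' 2 : ℂ) * ((z' 1 : ℂ))⁻¹) * (1 - (z' 2 : ℂ) * ((z' 0 : ℂ))⁻¹))) * Φ z')
        (fun j => k j * Circle.exp (s * (![1, -1, 0] : Fin 3 → ℝ) j))) 0 =
      2 * I * ((k 0 : ℂ) * ((k 2 : ℂ))⁻¹) * (1 - (k 2 : ℂ) * ((k 0 : ℂ))⁻¹) ^ 2 * Φ k := by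
  have hD := (contDiff_rhoWeylDelta_ray k (![1, -1, 0] : Fin 3 → ℝ)).contDiffAt (x := (0 : ℝ))
  have h := deriv_mul_eq_of_odd (hD.of_le (by exact_mod_cast ENat.natCast_le_of_coe_top_le_withTop le_rfl 1)) hP (fun s => rhoWeylDelta_normalRay_odd k hk s)
  rw [deriv_rhoWeylDelta_normalRay_zero k hk] at h
  simp only [zero_mul, Circle.exp_zero, mul_one] at h
  exact h

/-- **`N²F(k) = 0`** at a compact-wall point: `(d/ds)²|₀ (ρ′Δ·Φ)(k·e^{isN⃗}) = 0` (`ρ′Δ` odd, `Φ` even along the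
normal ray). [cite: Rogawski1990, §8.4 pp. 126–127] -/
theorem iteratedDeriv_two_rhoWeylDelta_mul_normalRay_zero (Φ : (Fin 3 → Circle) → ℂ)
    (hΦ : ∀ z : Fin 3 → Circle, Φ (z ∘ (Equiv.swap (0 : Fin 3) 1)) = Φ z) (k : Fin 3 → Circle) (hk : k 0 = k 1)
    (hP : ContDiffAt ℝ 2 (fun s : ℝ => Φ (fun j => k j * Circle.exp (s * (![1, -1, 0] : Fin 3 → ℝ) j))) 0) :
    iteratedDeriv 2 (fun s : ℝ => (fun z' : Fin 3 → Circle =>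
        ((z' 0 : ℂ) * ((z' 2 : ℂ))⁻¹ * ((1 - (z' 1 : ℂ) * ((z' 0 : ℂ))⁻¹) * (1 - (z' 2 : ℂ) * ((z' 1 : ℂ))⁻¹) * (1 - (z' 2 : ℂ) * ((z' 0 : ℂ))⁻¹))) * Φ z')
        (fun j => k j * Circle.exp (s * (![1, -1, 0] : Fin 3 → ℝ) j))) 0 = 0 := by
  have hD := (contDiff_rhoWeylDelta_ray k (![1, -1, 0] : Fin 3 → ℝ)).contDiffAt (x := (0 : ℝ))
  exact iteratedDeriv_two_mul_eq_zero_of_odd_even (hD.of_le (by exact_mod_cast ENat.natCast_le_of_coe_top_le_withTop le_rfl 2)) hP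
    (fun s => rhoWeylDelta_normalRay_odd k hk s) (fun s => comp_normalRay_even Φ hΦ k hk s)

/-- **`N³F(k) = D‴(0)·Φ(k) + 3·D′(0)·N²Φ(k)`** at a compact-wall point, in the letter's token:
`(d/ds)³|₀ (ρ′Δ·Φ)(k·e^{isN⃗}) = 2i·(k₀/k₂)·(8w − 1 − w²)·Φ(k) + 3·(2i·(k₀/k₂)·(1 − w)²)·(d/ds)²|₀ Φ(k·e^{isN⃗})`,
`w = k₂/k₀`. [cite: Rogawski1990, §8.4 pp. 126–127] -/
theorem iteratedDeriv_three_rhoWeylDelta_mul_normalRay_zero (Φ : (Fin 3 → Circle) → ℂ)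
    (hΦ : ∀ z : Fin 3 → Circle, Φ (z ∘ (Equiv.swap (0 : Fin 3) 1)) = Φ z) (k : Fin 3 → Circle) (hk : k 0 = k 1)
    (hP : ContDiffAt ℝ 3 (fun s : ℝ => Φ (fun j => k j * Circle.exp (s * (![1, -1, 0] : Fin 3 → ℝ) j))) 0) :
    iteratedDeriv 3 (fun s : ℝ => (fun z' : Fin 3 → Circle =>
        ((z' 0 : ℂ) * ((z' 2 : ℂ))⁻¹ * ((1 - (z' 1 : ℂ) * ((z' 0 : ℂ))⁻¹) * (1 - (z' 2 : ℂ) * ((z' 1 : ℂ))⁻¹) * (1 - (z' 2 : ℂ) * ((z' 0 : ℂ))⁻¹))) * Φ z')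
        (fun j => k j * Circle.exp (s * (![1, -1, 0] : Fin 3 → ℝ) j))) 0 =
      2 * I * ((k 0 : ℂ) * ((k 2 : ℂ))⁻¹) * (8 * ((k 2 : ℂ) * ((k 0 : ℂ))⁻¹) - 1 - ((k 2 : ℂ) * ((k 0 : ℂ))⁻¹) ^ 2) * Φ k
        + 3 * (2 * I * ((k 0 : ℂ) * ((k 2 : ℂ))⁻¹) * (1 - (k 2 : ℂ) * ((k 0 : ℂ))⁻¹) ^ 2) *
          iteratedDeriv 2 (fun s : ℝ => Φ (fun j => k j * Circle.exp (s * (![1, -1, 0] : Fin 3 → ℝ) j))) 0 := by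
  have hD := (contDiff_rhoWeylDelta_ray k (![1, -1, 0] : Fin 3 → ℝ)).contDiffAt (x := (0 : ℝ))
  have h := iteratedDeriv_three_mul_eq_of_odd_even (hD.of_le (by exact_mod_cast ENat.natCast_le_of_coe_top_le_withTop le_rfl 3)) hP
    (fun s => rhoWeylDelta_normalRay_odd k hk s) (fun s => comp_normalRay_even Φ hΦ k hk s)
  rw [deriv_rhoWeylDelta_normalRay_zero k hk, iteratedDeriv_three_rhoWeylDelta_normalRay_zero k hk] at h
  simp only [zero_mul, Circle.exp_zero, mul_one] at h
  exact h

end WallReadings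

end Literature.NumberTheory.Rogawski1990
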